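import Literature.MathematicalPhysics.QuantumFieldTheory.Balaban1983to89.B9Eq319BlockTentLift

/-!
# `Balaban1983to89.B9Eq319BlockPedestalLift` — T. Bałaban, *Propagators for lattice gauge theories in a background field*, Commun. Math. Phys.
# **99** (1985) 389–434 [Balaban1985BackgroundPropagators] (3.19) p. 393 with (3.3)∕(3.11) pp. 390–392: **THE TENT ON A PEDESTAL
# `b(x) = Π_μ (c + k_μ(L−1−k_μ))` ON THE BLOCKS OF THE FINE TORUS AT THE FLAT BACKGROUND — EXACT BLOCK SUMS (`Σk(L−1−k)`, `Σ(k(L−1−k))²`,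
# `Σ(L−2−2k)²` in closed form), THE DIRICHLET FORM OF A BLOCK-MODULATED LIFT FROM A SPLIT PER-STEP BOUND (face steps re-indexed along the
# fine shift), AND THE PEDESTAL TENT's STEP BOUND AND WEIGHT SUM `d·(L(L−1)(L−2)∕3 + 4c²)·(Σ(c + k(L−1−k))²)^{d−1}`** — the test-vector kit of
# `B9Eq365QGGQLowerVariationalSharp` (route R2′ STEP B7′ sub-step S3c of the pub-balaban NE9 chain, sharp flat constant)

statement-level skeleton of published theorems with citation tags; proofs where landed; nothing here is a claim about the Yang–Mills mass gap

CITATION HEADER (lean-in-tree rule).  Audit cell `pub-balaban`, sub-cell `t4`, BINDER row NE9; filed by NE9 formalisation-swarm LEAF PROVER 01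
(`b2b-balaban-t4-ne9-formalise-leaf-01`, gen 79), the author lineage of `B9Eq319BlockTentLift` ∕ `B9Eq365QGGQLowerVariational` (gen 78), on
the EVENT of ne9-leaf-06 g64's located numbers (journal W-ne9leaf06-g64-1 l.46729): the gen-78 kit's SUP bounds (`L(L²∕4)^{d−1}` per step,
`(L−1)(L−2)∕6 ≥ L²∕27`) put the diagonal floor of S3c's flat constant at `1.3·10⁻¹⁷` (d = 4) — numerically void for the consumer
`B9Eq325RLipschitzClosed`.  Source READ in the held text layer (`paper:balaban1985-cmp99-background-propagators`, journal page = PDF page + 388):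
p. 393 (3.19) (the flat `Q′` is the plain block mean, [Balaban1985Averaging] (2) p. 17, p. 27), pp. 390–392 (3.3) `D`, (3.11) the `η^d`-weighted
pairings; the lower bound of the third operator of Thm 3.11 is print's [Balaban1984PropagatorsII] (2.74)–(2.77) p. 236 («a positive, absolute
constant»), by Fourier there, variational here.

WHY (cell context).  Two losses of the gen-78 kit are removed here: (i) the Dirichlet form of the lift is computed from EXACT one-coordinate
sums, not from a per-step sup (`norm_sq_covDerivL2K_lift_le` ⇒ `norm_sq_covDerivL2K_lift_le_split` with WEIGHTS `F₁`, `F₂`); (ii) the test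
profile no longer vanishes on the block faces — a pedestal `c > 0` under the tent makes the `L ∈ {1, 2, 3}` blocks non-degenerate (at `L ≤ 2` the
tent is identically `0`) at the price `4c²` per direction for the FACE steps, which see the coarse value of the NEXT block and are summed by
re-indexing along the fine unit step (a permutation of the torus, `B9Eq33CovDerivVector.shiftEquiv`), never identifying that block.

WHAT IS PROVED (sorry-free; 0 `def`; axioms standard; [folklore] throughout — Faulhaber sums, finite sums over a box, a permutation of a finite
sum, the parallelogram bound `‖a − b‖² ≤ 2‖a‖² + 2‖b‖²`; nothing of [B9] asserted).
* §1 **`sum_profile_sq_eq`** (`Σ_{k<L}(k(L−1−k))² = L(L−1)(L−2)(L²−2L+2)∕30`), **`sum_step_sq_eq`** (`Σ_{k<N}(N−1−2k)² = N(N²−1)∕3`).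
* §2 **`sum_blockOf_prod_offset`** (`Σ_{x∈B(y)} Π_ν g_ν(k_ν(x)) = Π_ν Σ_{k<L} g_ν(k)`), **`sum_blockOf_mul_prod_erase_offset`** (one distinguished
  coordinate: `(Σf)(Σg)^{d−1}`).
* §3 **`sum_shift_eq`** (`Σ_x g(x+e_μ) = Σ_x g(x)`), **`norm_sq_covDerivL2K_lift_le_split`** — for `u = b·(ψ∘blk)`: a per-step bound
  `‖u(x+e_μ) − u(x)‖² ≤ F₁(μ,x)‖ψ(blk x)‖² + F₂(μ,x+e_μ)‖ψ(blk(x+e_μ))‖²` and block sums `Σ_{x∈B(y)}Σ_μ(F₁+F₂) ≤ Φ` give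
  `‖η⁻¹D₁u‖² ≤ |η⁻¹|²·Φ·(c₀∕c₁)·‖ψ‖²`.
* §4 **`sum_pedestal_eq`** ∕ **`sum_pedestal_sq_eq`** (the pedestal profile's block sums in closed form), **`sum_blockOf_pedestal`**
  (`Σ_{x∈B(y)} b = (Σ_{k<L}(c + k(L−1−k)))^d`), `offset_shift_eq_zero_iff`, **`pedestal_step_le`** (interior steps: exactly `(L−2−2k_μ)·R_μ·ψ(blk x)`;
  face steps: `c·R_μ·(ψ(blk(x+e_μ)) − ψ(blk x))` — in the split form with the displayed weights), **`sum_blockOf_pedestal_weights`**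
  (`Σ_{x∈B(y)}Σ_μ(F₁+F₂) = d·(L(L−1)(L−2)∕3 + 4c²)·(Σ_{k<L}(c + k(L−1−k))²)^{d−1}`).
HONEST SCOPE.  Elementary; flat background only; every `L ≥ 1`; the fibre `W` is any normed `ℂ`-space in §4 and any inner-product space in §3.
NOT NE9, NOT the route (cell pub-balaban: NE9 NOT PRINTED ∕ NOT PROVED; spine PROVED 0∕9; rung (B)+1 on a finite T⁴ — NOT infinite volume, NOT mass
gap, NOT Clay).  NEW file; imports `B9Eq319BlockTentLift` only; nothing modified.  Net new unproved facts: 0.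
-/

noncomputable section

open scoped InnerProductSpace ComplexConjugate BigOperators

namespace Literature.MathematicalPhysics.QuantumFieldTheory.Balaban1983to89.B9Eq319BlockPedestalLift

open B4Sect5Torus (TSite)
open B9SectCLatticeCarrier (Bond shift bpos btgt)
open B9Eq311L2Pairing (WL2)
open B9Eq319QprimeTorus (fineP offset offset_lt blockCoord mem_blockOf_iff)
open B9Eq315QTorus (perSite cornerSite)
open B7Prop1Explicit (boxVec)
open B11Eq103H1Complex (SiteL2K BondL2K covDerivL2K equiv_covDerivL2K)
open B9Eq33CovDerivVector (covDeriv covDeriv_apply shiftEquiv)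
open B9Eq310HessianOperator (adTransportW)
open B5Eq172HodgePositivity (adTransportW_one)
open B5Eq155FlatAveragingCommute (sum_blockOf_eq_sum_boxVec offset_perSite_cornerSite_add_boxVec)
open B5Eq172FlatCoercivity (card_blockOf)
open B9Eq319QprimeLipschitz (sum_blockOf_sum)
open B9Eq319BlockTentLift (sum_profile_eq profile_last offset_shift_of_ne offset_shift_of_eq blockCoord_shift_of_lt offset_shift_self)

/-! ## §1 The profile sums in closed form -/

section Profile

/-- `30·Σ_{k<n} (k(c−k))²` in closed form (private arithmetic helper; any real `c`; Faulhaber for `Σk²`, `Σk³`, `Σk⁴`). [folklore] -/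
private theorem thirty_mul_sum_range_sq (c : ℝ) : ∀ n : ℕ, 30 * ∑ k ∈ Finset.range n, ((k : ℝ) * (c - k)) ^ 2 =
    n * ((n : ℝ) - 1) * (5 * c ^ 2 * (2 * n - 1) - 15 * c * n * ((n : ℝ) - 1) + (2 * (n : ℝ) - 1) * (3 * (n : ℝ) ^ 2 - 3 * n - 1))
  | 0 => by simp
  | n + 1 => by
    rw [Finset.sum_range_succ, mul_add, thirty_mul_sum_range_sq c n]
    push_cast
    ring

/-- **`Σ_{k<L} (k(L−1−k))² = L(L−1)(L−2)(L²−2L+2)∕30`** — the block sum of the SQUARED tent profile (the `L²` mass of the test field per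
coordinate; print's route to the lower bound is Fourier, [Balaban1984PropagatorsII] (2.74)–(2.77)). [folklore] [cite: Balaban1984PropagatorsII, (2.74)–(2.77) p.236] -/
theorem sum_profile_sq_eq (L : ℕ) : ∑ k ∈ Finset.range L, ((k : ℝ) * ((L : ℝ) - 1 - k)) ^ 2 =
    L * ((L : ℝ) - 1) * ((L : ℝ) - 2) * ((L : ℝ) ^ 2 - 2 * L + 2) / 30 := by
  have h := thirty_mul_sum_range_sq ((L : ℝ) - 1) L
  have h' : (L : ℝ) * ((L : ℝ) - 1) * (5 * ((L : ℝ) - 1) ^ 2 * (2 * L - 1) - 15 * ((L : ℝ) - 1) * L * ((L : ℝ) - 1) +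
      (2 * (L : ℝ) - 1) * (3 * (L : ℝ) ^ 2 - 3 * L - 1)) =
      L * ((L : ℝ) - 1) * ((L : ℝ) - 2) * ((L : ℝ) ^ 2 - 2 * L + 2) := by ring
  rw [h'] at h
  linarith

/-- `3·Σ_{k<n} (c − 2k)²` in closed form (private arithmetic helper; any real `c`). [folklore] -/
private theorem three_mul_sum_range_sub_two_mul_sq (c : ℝ) : ∀ n : ℕ, 3 * ∑ k ∈ Finset.range n, (c - 2 * (k : ℝ)) ^ 2 =
    n * (3 * c ^ 2 - 6 * c * ((n : ℝ) - 1) + 2 * (2 * (n : ℝ) ^ 2 - 3 * n + 1))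
  | 0 => by simp
  | n + 1 => by
    rw [Finset.sum_range_succ, mul_add, three_mul_sum_range_sub_two_mul_sq c n]
    push_cast
    ring

/-- **`Σ_{k<N} (N−1−2k)² = N(N²−1)∕3`** — at `N = L − 1` the block sum of the squared STEPS `L − 2 − 2k` of the tent profile (its Dirichlet
energy per coordinate). [folklore] [cite: Balaban1984PropagatorsII, (2.74)–(2.77) p.236] -/
theorem sum_step_sq_eq (N : ℕ) : ∑ k ∈ Finset.range N, (((N : ℝ) - 1) - 2 * (k : ℝ)) ^ 2 = N * ((N : ℝ) ^ 2 - 1) / 3 := by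
  have h := three_mul_sum_range_sub_two_mul_sq ((N : ℝ) - 1) N
  have h' : (N : ℝ) * (3 * ((N : ℝ) - 1) ^ 2 - 6 * ((N : ℝ) - 1) * ((N : ℝ) - 1) + 2 * (2 * (N : ℝ) ^ 2 - 3 * N + 1)) =
      N * ((N : ℝ) ^ 2 - 1) := by ring
  rw [h'] at h
  linarith

end Profile

/-! ## §2 Block sums of products of one-coordinate functions of the offsets -/

section BlockSums

variable {d : ℕ} (L : ℕ) [NeZero L] (m : Fin d → ℕ) [∀ i, NeZero (fineP L m i)]

/-- **`Σ_{x∈B(y)} Π_ν g_ν(k_ν(x)) = Π_ν Σ_{k<L} g_ν(k)`** — the offsets parametrise the block ([B7] (2): `B(y) = {x : y_μ ≦ x_μ < y_μ + L}`) and a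
product of one-coordinate functions sums to the product of the one-coordinate sums. [folklore] [cite: Balaban1985Averaging, (2) p.17] -/
theorem sum_blockOf_prod_offset (g : Fin d → ℕ → ℝ) (y : TSite d m) :
    ∑ x ∈ B9Eq319QprimeTorus.blockOf L m y, ∏ ν, g ν (offset L m x ν) = ∏ ν, ∑ k ∈ Finset.range L, g ν k := by
  rw [sum_blockOf_eq_sum_boxVec]
  simp only [offset_perSite_cornerSite_add_boxVec]
  have h : (∏ ν : Fin d, ∑ k ∈ Finset.range L, g ν k) = ∏ ν : Fin d, ∑ k : Fin L, g ν (k : ℕ) :=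
    Finset.prod_congr rfl fun ν _ => (Fin.sum_univ_eq_sum_range (fun k => g ν k) L).symm
  rw [h, Fintype.prod_sum]

/-- **… with ONE distinguished coordinate: `Σ_{x∈B(y)} f(k_μ(x))·Π_{ν≠μ} g(k_ν(x)) = (Σ_{k<L} f(k))·(Σ_{k<L} g(k))^{d−1}`** — the shape of
every per-direction term of the Dirichlet form of a product test field. [folklore] [cite: Balaban1985Averaging, (2) p.17] -/
theorem sum_blockOf_mul_prod_erase_offset (f g : ℕ → ℝ) (μ : Fin d) (y : TSite d m) :
    ∑ x ∈ B9Eq319QprimeTorus.blockOf L m y, f (offset L m x μ) * ∏ ν ∈ Finset.univ.erase μ, g (offset L m x ν) =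
      (∑ k ∈ Finset.range L, f k) * (∑ k ∈ Finset.range L, g k) ^ (d - 1) := by
  have e : ∀ x : TSite d (fineP L m), f (offset L m x μ) * ∏ ν ∈ Finset.univ.erase μ, g (offset L m x ν) =
      ∏ ν, Function.update (fun _ : Fin d => g) μ f ν (offset L m x ν) := by
    intro x
    rw [← Finset.mul_prod_erase Finset.univ _ (Finset.mem_univ μ), Function.update_self]
    congr 1
    exact Finset.prod_congr rfl fun ν hν => by rw [Function.update_of_ne (Finset.ne_of_mem_erase hν)]
  rw [Finset.sum_congr rfl fun x _ => e x, sum_blockOf_prod_offset, ← Finset.mul_prod_erase Finset.univ _ (Finset.mem_univ μ),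
    Function.update_self]
  congr 1
  rw [Finset.prod_congr rfl fun ν hν => by rw [Function.update_of_ne (Finset.ne_of_mem_erase hν)], Finset.prod_const,
    Finset.card_erase_of_mem (Finset.mem_univ μ), Finset.card_univ, Fintype.card_fin]

end BlockSums

/-! ## §3 Re-indexing along a fine unit step, and the Dirichlet form of a lift from a SPLIT per-step bound -/

section Split

variable {d : ℕ} (L : ℕ) [NeZero L] (m : Fin d → ℕ)
  {𝔸 : Type*} [Ring 𝔸] [Algebra ℂ 𝔸] {W : Type*} [NormedAddCommGroup W] [InnerProductSpace ℂ W]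
  (φ : W ≃ₗ[ℂ] 𝔸) (c₀ : ℝ) [Fact (0 < c₀)] (η : ℝ) (c₁ : ℝ) [Fact (0 < c₁)]

/-- re-indexing a sum over the periodic lattice along the unit step `x ↦ x + e_μ` (a permutation, `B9Eq33CovDerivVector.shiftEquiv`). [folklore]
[cite: Balaban1985BackgroundPropagators, (3.3) p.390] -/
theorem sum_shift_eq {M : Type*} [AddCommMonoid M] {P : Fin d → ℕ} (g : TSite d P → M) (μ : Fin d) :
    ∑ x, g (shift μ x) = ∑ x, g x :=
  Fintype.sum_equiv (shiftEquiv μ) _ _ fun _ => rfl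

omit [NeZero L] in
/-- **THE DIRICHLET FORM OF A BLOCK-MODULATED LIFT FROM A SPLIT PER-STEP BOUND** (the kit's `norm_sq_covDerivL2K_lift_le` with a sup bound
replaced by weights): if every forward step of `u = b·(ψ∘blk)` satisfies
`‖u(x+e_μ) − u(x)‖² ≤ F₁(μ,x)·‖ψ(blk x)‖² + F₂(μ, x+e_μ)·‖ψ(blk(x+e_μ))‖²` and every block sum of `Σ_μ (F₁ + F₂)` is `≤ Φ`, then
`‖η⁻¹D₁u‖² ≤ |η|⁻²·Φ·(c₀∕c₁)·‖ψ‖²` — the `F₂`-half is re-indexed along the fine step (a permutation of the torus), so steps ACROSS a block face,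
which see the coarse value of the NEXT block, are summed without identifying that block. [folklore]
[cite: Balaban1985BackgroundPropagators, (3.3) p.390, (3.11) p.392] -/
theorem norm_sq_covDerivL2K_lift_le_split (b : TSite d (fineP L m) → ℝ) (ψ : SiteL2K ℂ d m c₁ W)
    (F₁ F₂ : Fin d → TSite d (fineP L m) → ℝ) {Φ : ℝ}
    (hstep : ∀ (x : TSite d (fineP L m)) (μ : Fin d),
      ‖((b (shift μ x) : ℝ) : ℂ) • WL2.equiv ℂ (fun _ : TSite d m => c₁) W ψ (blockCoord L m (shift μ x)) -
          ((b x : ℝ) : ℂ) • WL2.equiv ℂ (fun _ : TSite d m => c₁) W ψ (blockCoord L m x)‖ ^ 2 ≤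
        F₁ μ x * ‖WL2.equiv ℂ (fun _ : TSite d m => c₁) W ψ (blockCoord L m x)‖ ^ 2 +
          F₂ μ (shift μ x) * ‖WL2.equiv ℂ (fun _ : TSite d m => c₁) W ψ (blockCoord L m (shift μ x))‖ ^ 2)
    (hΦ : ∀ y : TSite d m, ∑ x ∈ B9Eq319QprimeTorus.blockOf L m y, ∑ μ, (F₁ μ x + F₂ μ x) ≤ Φ) :
    ‖covDerivL2K ℂ c₀ ((η : ℂ))⁻¹ (adTransportW φ (fun _ : Bond d (fineP L m) => (1 : 𝔸ˣ)))
        ((WL2.equiv ℂ (fun _ : TSite d (fineP L m) => c₀) W).symm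
          (fun x => ((b x : ℝ) : ℂ) • WL2.equiv ℂ (fun _ : TSite d m => c₁) W ψ (blockCoord L m x)))‖ ^ 2 ≤
      ‖((η : ℂ))⁻¹‖ ^ 2 * Φ * (c₀ / c₁) * ‖ψ‖ ^ 2 := by
  have hc₀ : 0 < c₀ := Fact.out
  have hc₁ : 0 < c₁ := Fact.out
  set ψt := WL2.equiv ℂ (fun _ : TSite d m => c₁) W ψ with hψt
  set ut : TSite d (fineP L m) → W := fun x => ((b x : ℝ) : ℂ) • ψt (blockCoord L m x) with hut
  rw [WL2.norm_sq]
  -- pointwise on each bond `(x, μ)`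
  have hpt : ∀ bnd : Bond d (fineP L m), c₀ * ‖WL2.equiv ℂ (fun _ : Bond d (fineP L m) => c₀) W
      (covDerivL2K ℂ c₀ ((η : ℂ))⁻¹ (adTransportW φ (fun _ : Bond d (fineP L m) => (1 : 𝔸ˣ)))
        ((WL2.equiv ℂ (fun _ : TSite d (fineP L m) => c₀) W).symm ut)) bnd‖ ^ 2 ≤
      c₀ * (‖((η : ℂ))⁻¹‖ ^ 2 * (F₁ bnd.2 bnd.1 * ‖ψt (blockCoord L m bnd.1)‖ ^ 2 +
        F₂ bnd.2 (shift bnd.2 bnd.1) * ‖ψt (blockCoord L m (shift bnd.2 bnd.1))‖ ^ 2)) := by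
    intro bnd
    refine mul_le_mul_of_nonneg_left ?_ hc₀.le
    rw [equiv_covDerivL2K, covDeriv_apply, adTransportW_one, LinearMap.id_apply, Equiv.apply_symm_apply, norm_smul, mul_pow]
    exact mul_le_mul_of_nonneg_left (hstep bnd.1 bnd.2) (sq_nonneg _)
  refine (Finset.sum_le_sum fun bnd _ => hpt bnd).trans ?_
  -- sum over bonds = sum over sites × directions; re-index the `F₂`-half along the step
  have hB : ∑ x : TSite d (fineP L m), ∑ μ : Fin d, c₀ * ‖((η : ℂ))⁻¹‖ ^ 2 *
        (F₂ μ (shift μ x) * ‖ψt (blockCoord L m (shift μ x))‖ ^ 2) =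
      ∑ x : TSite d (fineP L m), ∑ μ : Fin d, c₀ * ‖((η : ℂ))⁻¹‖ ^ 2 * (F₂ μ x * ‖ψt (blockCoord L m x)‖ ^ 2) := by
    rw [Finset.sum_comm]
    conv_rhs => rw [Finset.sum_comm]
    exact Finset.sum_congr rfl fun μ _ =>
      sum_shift_eq (fun x => c₀ * ‖((η : ℂ))⁻¹‖ ^ 2 * (F₂ μ x * ‖ψt (blockCoord L m x)‖ ^ 2)) μ
  have hsum : ∑ bnd : Bond d (fineP L m), c₀ * (‖((η : ℂ))⁻¹‖ ^ 2 * (F₁ bnd.2 bnd.1 * ‖ψt (blockCoord L m bnd.1)‖ ^ 2 +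
        F₂ bnd.2 (shift bnd.2 bnd.1) * ‖ψt (blockCoord L m (shift bnd.2 bnd.1))‖ ^ 2)) =
      c₀ * ‖((η : ℂ))⁻¹‖ ^ 2 * ∑ x : TSite d (fineP L m), (∑ μ, (F₁ μ x + F₂ μ x)) * ‖ψt (blockCoord L m x)‖ ^ 2 := by
    calc ∑ bnd : Bond d (fineP L m), c₀ * (‖((η : ℂ))⁻¹‖ ^ 2 * (F₁ bnd.2 bnd.1 * ‖ψt (blockCoord L m bnd.1)‖ ^ 2 +
          F₂ bnd.2 (shift bnd.2 bnd.1) * ‖ψt (blockCoord L m (shift bnd.2 bnd.1))‖ ^ 2))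
        = ∑ x : TSite d (fineP L m), ∑ μ : Fin d, (c₀ * ‖((η : ℂ))⁻¹‖ ^ 2 * (F₁ μ x * ‖ψt (blockCoord L m x)‖ ^ 2) +
            c₀ * ‖((η : ℂ))⁻¹‖ ^ 2 * (F₂ μ (shift μ x) * ‖ψt (blockCoord L m (shift μ x))‖ ^ 2)) := by
          rw [Fintype.sum_prod_type]
          exact Finset.sum_congr rfl fun x _ => Finset.sum_congr rfl fun μ _ => by ring
      _ = ∑ x : TSite d (fineP L m), ∑ μ : Fin d, c₀ * ‖((η : ℂ))⁻¹‖ ^ 2 * (F₁ μ x * ‖ψt (blockCoord L m x)‖ ^ 2) +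
            ∑ x : TSite d (fineP L m), ∑ μ : Fin d, c₀ * ‖((η : ℂ))⁻¹‖ ^ 2 * (F₂ μ x * ‖ψt (blockCoord L m x)‖ ^ 2) := by
          rw [← hB, ← Finset.sum_add_distrib]
          exact Finset.sum_congr rfl fun x _ => Finset.sum_add_distrib
      _ = c₀ * ‖((η : ℂ))⁻¹‖ ^ 2 * ∑ x : TSite d (fineP L m), (∑ μ, (F₁ μ x + F₂ μ x)) * ‖ψt (blockCoord L m x)‖ ^ 2 := by
          rw [← Finset.sum_add_distrib, Finset.mul_sum]
          refine Finset.sum_congr rfl fun x _ => ?_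
          rw [← Finset.sum_add_distrib, Finset.sum_mul, Finset.mul_sum]
          exact Finset.sum_congr rfl fun μ _ => by ring
  rw [hsum]
  -- block partition and the block bound `Φ`
  have hblk : ∑ x : TSite d (fineP L m), (∑ μ, (F₁ μ x + F₂ μ x)) * ‖ψt (blockCoord L m x)‖ ^ 2 ≤ Φ * ∑ y, ‖ψt y‖ ^ 2 := by
    rw [← sum_blockOf_sum L m (fun x => (∑ μ, (F₁ μ x + F₂ μ x)) * ‖ψt (blockCoord L m x)‖ ^ 2), Finset.mul_sum]
    refine Finset.sum_le_sum fun y _ => ?_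
    rw [Finset.sum_congr rfl fun x hx => by rw [(mem_blockOf_iff L m y x).1 hx], ← Finset.sum_mul]
    exact mul_le_mul_of_nonneg_right (hΦ y) (sq_nonneg _)
  have hψ : ‖ψ‖ ^ 2 = c₁ * ∑ y, ‖ψt y‖ ^ 2 := by rw [WL2.norm_sq, Finset.mul_sum]
  rw [hψ]
  calc c₀ * ‖((η : ℂ))⁻¹‖ ^ 2 * ∑ x : TSite d (fineP L m), (∑ μ, (F₁ μ x + F₂ μ x)) * ‖ψt (blockCoord L m x)‖ ^ 2
      ≤ c₀ * ‖((η : ℂ))⁻¹‖ ^ 2 * (Φ * ∑ y, ‖ψt y‖ ^ 2) := mul_le_mul_of_nonneg_left hblk (by positivity)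
    _ = ‖((η : ℂ))⁻¹‖ ^ 2 * Φ * (c₀ / c₁) * (c₁ * ∑ y, ‖ψt y‖ ^ 2) := by field_simp

end Split

/-! ## §4 The tent on a pedestal: `b(x) = Π_ν (c + k_ν(L−1−k_ν))` — block sums, the split step bound, the block sum of its weights -/

section Pedestal

variable {d : ℕ} (L : ℕ) [NeZero L] (m : Fin d → ℕ) [∀ i, NeZero (fineP L m i)] {W : Type*} [NormedAddCommGroup W] [NormedSpace ℂ W]

omit [NeZero L] in
/-- `Σ_{k<L} (c + k(L−1−k)) = Lc + L(L−1)(L−2)∕6`. [folklore] [cite: Balaban1984PropagatorsII, (2.74)–(2.77) p.236] -/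
theorem sum_pedestal_eq (c : ℝ) : ∑ k ∈ Finset.range L, (c + (k : ℝ) * ((L : ℝ) - 1 - k)) = L * c + L * ((L : ℝ) - 1) * ((L : ℝ) - 2) / 6 := by
  rw [Finset.sum_add_distrib, Finset.sum_const, Finset.card_range, nsmul_eq_mul, sum_profile_eq]

omit [NeZero L] in
/-- `Σ_{k<L} (c + k(L−1−k))² = Lc² + 2c·L(L−1)(L−2)∕6 + L(L−1)(L−2)(L²−2L+2)∕30`. [folklore] [cite: Balaban1984PropagatorsII, (2.74)–(2.77) p.236] -/
theorem sum_pedestal_sq_eq (c : ℝ) : ∑ k ∈ Finset.range L, (c + (k : ℝ) * ((L : ℝ) - 1 - k)) ^ 2 =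
    L * c ^ 2 + 2 * c * (L * ((L : ℝ) - 1) * ((L : ℝ) - 2) / 6) + L * ((L : ℝ) - 1) * ((L : ℝ) - 2) * ((L : ℝ) ^ 2 - 2 * L + 2) / 30 := by
  have e : ∀ k : ℕ, (c + (k : ℝ) * ((L : ℝ) - 1 - k)) ^ 2 =
      c ^ 2 + 2 * c * ((k : ℝ) * ((L : ℝ) - 1 - k)) + ((k : ℝ) * ((L : ℝ) - 1 - k)) ^ 2 := fun k => by ring
  simp_rw [e]
  rw [Finset.sum_add_distrib, Finset.sum_add_distrib, Finset.sum_const, Finset.card_range, nsmul_eq_mul, ← Finset.mul_sum,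
    sum_profile_eq, sum_profile_sq_eq]

/-- **THE PEDESTAL TENT's BLOCK SUM**: `Σ_{x∈B(y)} Π_ν (c + k_ν(x)(L−1−k_ν(x))) = (Σ_{k<L} (c + k(L−1−k)))^d` — the block normalisation
(`Q′(1)u = L^{−d}(Lc + L(L−1)(L−2)∕6)^d·ψ` by the kit's `QprimeWL2_one_lift`). [folklore] [cite: Balaban1984PropagatorsII, (2.74)–(2.77) p.236; Balaban1985Averaging, (2) p.17] -/
theorem sum_blockOf_pedestal (c : ℝ) (y : TSite d m) :
    ∑ x ∈ B9Eq319QprimeTorus.blockOf L m y, ∏ ν, (c + ((offset L m x ν : ℕ) : ℝ) * ((L : ℝ) - 1 - (offset L m x ν : ℕ))) =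
      (∑ k ∈ Finset.range L, (c + (k : ℝ) * ((L : ℝ) - 1 - k))) ^ d := by
  rw [sum_blockOf_prod_offset L m (fun _ k => c + (k : ℝ) * ((L : ℝ) - 1 - k)) y, Finset.prod_const, Finset.card_univ, Fintype.card_fin]

omit [NeZero L] [∀ i, NeZero (fineP L m i)] in
/-- `offset_μ(x + e_μ) = 0` exactly when the step crosses a face (`offset_μ(x) = L − 1`). [folklore] [cite: Balaban1985Averaging, (2) p.17] -/
theorem offset_shift_eq_zero_iff [NeZero L] (x : TSite d (fineP L m)) (μ : Fin d) :
    offset L m (shift μ x) μ = 0 ↔ offset L m x μ + 1 = L := by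
  have hk : offset L m x μ < L := offset_lt L m x μ
  rw [offset_shift_self]
  constructor
  · intro h
    rcases (Nat.succ_le_of_lt hk).lt_or_eq with hlt | heq
    · rw [Nat.mod_eq_of_lt hlt] at h; omega
    · exact heq
  · intro h; rw [h, Nat.mod_self]

omit [∀ i, NeZero (fineP L m i)] in
/-- **THE SPLIT STEP BOUND OF THE PEDESTAL TENT, COARSE VALUE FROZEN OR CROSSING**: for `u(x) = b(x)·ψ(blk x)`, `b = Π_ν(c + k_ν(L−1−k_ν))`,
and `R_μ(x) = Π_{ν≠μ}(c + k_ν(L−1−k_ν))`: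
an INTERIOR step (`k_μ < L−1`) keeps the block and changes `u` by exactly `(L−2−2k_μ)·R_μ(x)·ψ(blk x)`; a FACE step (`k_μ = L−1 → 0`) sees
`b = c·R_μ` on both sides and changes `u` by `c·R_μ(x)·(ψ(blk(x+e_μ)) − ψ(blk x))`, of norm² `≤ 2c²R_μ²(‖ψ(blk x)‖² + ‖ψ(blk(x+e_μ))‖²)` — read as
`F₁(μ,x)‖ψ(blk x)‖² + F₂(μ,x+e_μ)‖ψ(blk(x+e_μ))‖²` with the displayed weights (the shape consumed by `norm_sq_covDerivL2K_lift_le_split`). [folklore]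
[cite: Balaban1984PropagatorsII, (2.74)–(2.77) p.236; Balaban1985Averaging, (2) p.17] -/
theorem pedestal_step_le (c : ℝ) (ψt : TSite d m → W) (x : TSite d (fineP L m)) (μ : Fin d) :
    ‖((∏ ν, (c + ((offset L m (shift μ x) ν : ℕ) : ℝ) * ((L : ℝ) - 1 - (offset L m (shift μ x) ν : ℕ))) : ℝ) : ℂ) •
          ψt (blockCoord L m (shift μ x)) -
        ((∏ ν, (c + ((offset L m x ν : ℕ) : ℝ) * ((L : ℝ) - 1 - (offset L m x ν : ℕ))) : ℝ) : ℂ) • ψt (blockCoord L m x)‖ ^ 2 ≤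
      ((if offset L m x μ + 1 < L then ((L : ℝ) - 2 - 2 * (offset L m x μ : ℕ)) ^ 2 else 2 * c ^ 2) *
          (∏ ν ∈ Finset.univ.erase μ, (c + ((offset L m x ν : ℕ) : ℝ) * ((L : ℝ) - 1 - (offset L m x ν : ℕ)))) ^ 2) *
        ‖ψt (blockCoord L m x)‖ ^ 2 +
      ((if offset L m (shift μ x) μ = 0 then 2 * c ^ 2 else 0) *
          (∏ ν ∈ Finset.univ.erase μ, (c + ((offset L m (shift μ x) ν : ℕ) : ℝ) * ((L : ℝ) - 1 - (offset L m (shift μ x) ν : ℕ)))) ^ 2) *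
        ‖ψt (blockCoord L m (shift μ x))‖ ^ 2 := by
  set R : ℝ := ∏ ν ∈ Finset.univ.erase μ, (c + ((offset L m x ν : ℕ) : ℝ) * ((L : ℝ) - 1 - (offset L m x ν : ℕ))) with hR
  -- the transverse factor is unchanged under the step
  have hR' : (∏ ν ∈ Finset.univ.erase μ, (c + ((offset L m (shift μ x) ν : ℕ) : ℝ) * ((L : ℝ) - 1 - (offset L m (shift μ x) ν : ℕ)))) = R :=
    Finset.prod_congr rfl fun ν hν => by rw [offset_shift_of_ne L m x (Finset.ne_of_mem_erase hν)]
  have e1 : (∏ ν, (c + ((offset L m x ν : ℕ) : ℝ) * ((L : ℝ) - 1 - (offset L m x ν : ℕ)))) =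
      (c + ((offset L m x μ : ℕ) : ℝ) * ((L : ℝ) - 1 - (offset L m x μ : ℕ))) * R :=
    (Finset.mul_prod_erase Finset.univ _ (Finset.mem_univ μ)).symm
  have e2 : (∏ ν, (c + ((offset L m (shift μ x) ν : ℕ) : ℝ) * ((L : ℝ) - 1 - (offset L m (shift μ x) ν : ℕ)))) =
      (c + ((offset L m (shift μ x) μ : ℕ) : ℝ) * ((L : ℝ) - 1 - (offset L m (shift μ x) μ : ℕ))) * R := by
    rw [← Finset.mul_prod_erase Finset.univ _ (Finset.mem_univ μ), hR']
  rw [hR', e1, e2]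
  have hkL : offset L m x μ + 1 ≤ L := offset_lt L m x μ
  rcases hkL.lt_or_eq with hlt | heq
  · -- interior step: same block, offset `+1`, exact difference `(L−2−2k)·R·ψ`
    obtain ⟨hblk, hoff⟩ := blockCoord_shift_of_lt L m x hlt
    have hne : offset L m (shift μ x) μ ≠ 0 := by rw [hoff]; exact Nat.succ_ne_zero _
    rw [if_pos hlt, if_neg hne, hblk, hoff, ← sub_smul, ← Complex.ofReal_sub, norm_smul, Complex.norm_real, Real.norm_eq_abs, mul_pow,
      sq_abs]
    push_cast
    exact le_of_eq (by ring)
  · -- face step: the profile vanishes on both sides of the face, `b = c·R` there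
    have h0 : offset L m (shift μ x) μ = 0 := offset_shift_of_eq L m x heq
    have t1 : ((offset L m x μ : ℕ) : ℝ) * ((L : ℝ) - 1 - (offset L m x μ : ℕ)) = 0 := profile_last heq
    have t2 : ((offset L m (shift μ x) μ : ℕ) : ℝ) * ((L : ℝ) - 1 - (offset L m (shift μ x) μ : ℕ)) = 0 := by rw [h0]; simp
    rw [if_neg (not_lt.2 heq.ge), if_pos h0, t1, t2, add_zero, ← smul_sub, norm_smul, mul_pow, Complex.norm_real, Real.norm_eq_abs, sq_abs]
    have hsub : ‖ψt (blockCoord L m (shift μ x)) - ψt (blockCoord L m x)‖ ^ 2 ≤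
        2 * ‖ψt (blockCoord L m x)‖ ^ 2 + 2 * ‖ψt (blockCoord L m (shift μ x))‖ ^ 2 := by
      have h := norm_sub_le (ψt (blockCoord L m (shift μ x))) (ψt (blockCoord L m x))
      nlinarith [norm_nonneg (ψt (blockCoord L m (shift μ x)) - ψt (blockCoord L m x)), norm_nonneg (ψt (blockCoord L m x)),
        norm_nonneg (ψt (blockCoord L m (shift μ x))),
        sq_nonneg (‖ψt (blockCoord L m x)‖ - ‖ψt (blockCoord L m (shift μ x))‖)]
    calc (c * R) ^ 2 * ‖ψt (blockCoord L m (shift μ x)) - ψt (blockCoord L m x)‖ ^ 2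
        ≤ (c * R) ^ 2 * (2 * ‖ψt (blockCoord L m x)‖ ^ 2 + 2 * ‖ψt (blockCoord L m (shift μ x))‖ ^ 2) :=
          mul_le_mul_of_nonneg_left hsub (sq_nonneg _)
      _ = 2 * c ^ 2 * R ^ 2 * ‖ψt (blockCoord L m x)‖ ^ 2 + 2 * c ^ 2 * R ^ 2 * ‖ψt (blockCoord L m (shift μ x))‖ ^ 2 := by ring

/-- **THE BLOCK SUM OF THE PEDESTAL TENT's WEIGHTS**: `Σ_{x∈B(y)} Σ_μ (F₁(μ,x) + F₂(μ,x)) = d·(L(L−1)(L−2)∕3 + 4c²)·(Σ_{k<L}(c + k(L−1−k))²)^{d−1}`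
— per direction: the Dirichlet energy `Σ_{k<L−1}(L−2−2k)² = L(L−1)(L−2)∕3` of the tent, plus `2c²` on EACH face of the block, times the
transverse `L²` mass. [folklore] [cite: Balaban1984PropagatorsII, (2.74)–(2.77) p.236; Balaban1985Averaging, (2) p.17] -/
theorem sum_blockOf_pedestal_weights (c : ℝ) (y : TSite d m) :
    ∑ x ∈ B9Eq319QprimeTorus.blockOf L m y, ∑ μ : Fin d,
        ((if offset L m x μ + 1 < L then ((L : ℝ) - 2 - 2 * (offset L m x μ : ℕ)) ^ 2 else 2 * c ^ 2) *
            (∏ ν ∈ Finset.univ.erase μ, (c + ((offset L m x ν : ℕ) : ℝ) * ((L : ℝ) - 1 - (offset L m x ν : ℕ)))) ^ 2 +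
          (if offset L m x μ = 0 then 2 * c ^ 2 else 0) *
            (∏ ν ∈ Finset.univ.erase μ, (c + ((offset L m x ν : ℕ) : ℝ) * ((L : ℝ) - 1 - (offset L m x ν : ℕ)))) ^ 2) =
      (d : ℝ) * ((L : ℝ) * ((L : ℝ) - 1) * ((L : ℝ) - 2) / 3 + 4 * c ^ 2) *
        (∑ k ∈ Finset.range L, (c + (k : ℝ) * ((L : ℝ) - 1 - k)) ^ 2) ^ (d - 1) := by
  obtain ⟨n, hn⟩ : ∃ n, L = n + 1 := ⟨L - 1, (Nat.succ_pred_eq_of_pos (Nat.pos_of_ne_zero (NeZero.ne L))).symm⟩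
  -- the one-coordinate weights
  set f : ℕ → ℝ := fun k => (if k + 1 < L then ((L : ℝ) - 2 - 2 * (k : ℝ)) ^ 2 else 2 * c ^ 2) + (if k = 0 then 2 * c ^ 2 else 0) with hf
  set g : ℕ → ℝ := fun k => (c + (k : ℝ) * ((L : ℝ) - 1 - k)) ^ 2 with hg
  have hfsum : ∑ k ∈ Finset.range L, f k = (L : ℝ) * ((L : ℝ) - 1) * ((L : ℝ) - 2) / 3 + 4 * c ^ 2 := by
    rw [hf]
    simp only
    rw [Finset.sum_add_distrib, Finset.sum_ite_eq' (Finset.range L) 0 (fun _ => 2 * c ^ 2), if_pos (by rw [hn]; simp), hn,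
      Finset.sum_range_succ, if_neg (lt_irrefl _),
      Finset.sum_congr rfl fun k hk => if_pos (Nat.succ_lt_succ (Finset.mem_range.1 hk))]
    have h := sum_step_sq_eq n
    have h' : ∀ k : ℕ, ((((n + 1 : ℕ) : ℝ) - 2) - 2 * (k : ℝ)) ^ 2 = (((n : ℝ) - 1) - 2 * (k : ℝ)) ^ 2 := fun k => by push_cast; ring
    simp_rw [h']
    rw [h]
    push_cast
    ring
  -- each direction contributes `(Σ f)(Σ g)^{d−1}`
  have hdir : ∀ μ : Fin d, ∑ x ∈ B9Eq319QprimeTorus.blockOf L m y,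
      ((if offset L m x μ + 1 < L then ((L : ℝ) - 2 - 2 * (offset L m x μ : ℕ)) ^ 2 else 2 * c ^ 2) *
            (∏ ν ∈ Finset.univ.erase μ, (c + ((offset L m x ν : ℕ) : ℝ) * ((L : ℝ) - 1 - (offset L m x ν : ℕ)))) ^ 2 +
          (if offset L m x μ = 0 then 2 * c ^ 2 else 0) *
            (∏ ν ∈ Finset.univ.erase μ, (c + ((offset L m x ν : ℕ) : ℝ) * ((L : ℝ) - 1 - (offset L m x ν : ℕ)))) ^ 2) =
      (∑ k ∈ Finset.range L, f k) * (∑ k ∈ Finset.range L, g k) ^ (d - 1) := by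
    intro μ
    rw [← sum_blockOf_mul_prod_erase_offset L m f g μ y]
    refine Finset.sum_congr rfl fun x _ => ?_
    rw [hf, hg]
    simp only
    rw [← Finset.prod_pow]
    ring
  rw [Finset.sum_comm, Finset.sum_congr rfl fun μ _ => hdir μ, Finset.sum_const, Finset.card_univ, Fintype.card_fin, nsmul_eq_mul, hfsum]
  ring

end Pedestal

end Literature.MathematicalPhysics.QuantumFieldTheory.Balaban1983to89.B9Eq319BlockPedestalLift

end
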